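import Literature.AlgebraicGeometry.HodgeTheory.ComplexTorusIntegralHodgeClassesKunnethProjectorsCommutation
import Literature.AlgebraicGeometry.HodgeTheory.ComplexTorusIntegralHodgeClassesKunnethComponentsActions
import HarnessLib

/-!
# The actions of `α ∘ π_{s,W}`: a correspondence restricted to one Künneth component of its SOURCE — `(α ∘ π_{s,W})_* = δ_{s,2p} α_*` on `Hdgᵖ(W, ℤ)`

Sequel of g30-#11 (`ComplexTorusIntegralHodgeClassesKunnethComponentsActions`: `(π_{s,X} ∘ α)_*(x) = δ_{s,2d} α_*(x)`, `(π_{s,X} ∘ α)^*(y) = δ_{s+2q,2 dim X}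
α^*(y)` — the projector on the TARGET side) and g31-#2 (`ComplexTorusIntegralHodgeClassesKunnethProjectorsCommutation`: `α ∘ π_{s,W} = π_{t,X} ∘ α`, `t + 2
dim W = 2a + s`). Here the Künneth projector sits on the SOURCE side: for a complex torus `W` of dimension `g_W`, `α ∈ Hdgᵃ(W × X, ℤ)`, `x ∈ Hdgᵖ(W, ℤ)`, `y ∈
Hdgᵠ(X, ℤ)`, the composite `α ∘ π_{s,W} = p₁₃_*(p₁₂^*π_{s,W} · p₂₃^*α)` on `W × (W × X)` (Fulton's convention, g27-#5) — the Künneth component of `α` of degree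
`2g_W − s` in the `W`-variables (g29-#8 §2) — acts by

* §1 **`integralHodgeClassesCorrComp_kunnethProjector_right_act`** — `(α ∘ π_{s,W})_*(x) = δ_{s,2p} · α_*(x)`: Fulton's Prop. 16.1.2 (a) `(α ∘ π_s)_* = α_* ∘
  (π_s)_*` with `(π_{s,W})_*` the projector of `H•(W)` onto `Hˢ(W)` (g29-#5 §4; Voisin p. 287 "`Id_k`"), so on `Hdgᵖ(W, ℤ) ⊂ H^{2p}(W, ℤ)` only `s = 2p`
  survives — proved here by moving the projector to the target (g31-#2) and g30-#11; `…_right_act_self`: `α_*(x) = (α ∘ π_{2p,W})_*(x)`;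
* §2 **`integralHodgeClassesCorrComp_kunnethProjector_right_coact`** — `(α ∘ π_{s,W})^*(y) = δ_{s + 2d′, 2g_W} · α^*(y)` for `α^*(y) ∈ Hdg^{d′}(W, ℤ)`:
  `(α ∘ π_s)^* = (π_s)^* ∘ α^*` and `(π_{s,W})^* = (ᵗπ_{s,W})_* = (π_{2g_W−s,W})_*` (Prop. 6.3.10) is the projector onto `H^{2g_W−s}(W)`;
  `…_right_coact_self`: `α^*(y) = (α ∘ π_{2g_W−2d′,W})^*(y)`.

With g30-#11 this completes Fulton's Example 16.1.15 / Voisin's Lemma 11.41 on the integral carriers: the map `Hdgᵖ(W, ℤ) → Hdgᵈ(X, ℤ)` induced by `α` is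
induced by the single two-sided Künneth piece `π_{2d,X} ∘ α ∘ π_{2p,W}` (g29-#13). Everything is proved; no definition and no named fact is introduced (D-0026).

## References
* [Fulton1998] W. Fulton, Intersection Theory, 2nd ed., Springer 1998, §16.1 Def. 16.1.1, Def. 16.1.2 and Prop. 16.1.2 (a) (p0293 L3–L7, p0295 L9–L22),
  Example 16.1.15 (p0302 L27–L33).
* [VoisinHodgeI2002] C. Voisin, Hodge Theory and Complex Algebraic Geometry I, CUP 2002, §11.3.3 Thm. 11.38, Lemma 11.41 and (11.11) (p0236 L5–L40,
  p0237 L1–L3), p. 287.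
* [Lange2023AbelianVarietiesComplex] H. Lange, Abelian Varieties over the Complex Numbers, Springer 2023, §6.3.3 Prop. 6.3.8 (p0317 L11–L16), §6.3.4
  Prop. 6.3.9 (b), Prop. 6.3.10, Prop. 6.3.11 (p0318 L1–L6, p0318 L47, p0319 L9–L21).
-/

noncomputable section

open CategoryTheory Function

namespace Literature.AlgebraicGeometry.HodgeTheory

open Literature.AlgebraicGeometry.Motives Literature.AlgebraicGeometry.Motives.HodgeStructure
open Literature.Geometry.Kaehler Literature.Geometry.Kaehler.ComplexTorus

namespace ComplexTorusCat

section SourceActions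

variable {W X : ComplexTorusCat} {gW gX gWW gWX gXX gT nT₁ gT₁ : ℕ} (hgg₁ : gW + gX = gWX) (hgg₂ : gX + gX = gXX) (hggT : gWX + gX = gT)
  (eW : Fin (2 * gW) ≃ W.toIsog.ι) (eX : Fin (2 * gX) ≃ X.toIsog.ι) (eWW : Fin (2 * gWW) ≃ (prodObj W W).toIsog.ι)
  (eWX : Fin (2 * gWX) ≃ (prodObj W X).toIsog.ι) (eXX : Fin (2 * gXX) ≃ (prodObj X X).toIsog.ι)
  (eT₁ : Fin nT₁ ≃ (prodObj W (prodObj W X)).toIsog.ι) (eT : Fin (2 * gT) ≃ (prodObj W (prodObj X X)).toIsog.ι)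
  (hW0 : 2 * gW + 2 * 0 = 2 * gW) (hgW : gW + gW = 2 * gW) (hcW : 2 * gW + 2 * gW = 2 * gWW) (hgWW : gWW + gWW = 2 * gWW)
  (hX0 : 2 * gX + 2 * 0 = 2 * gX) (hgX : gX + gX = 2 * gX) (hcX : 2 * gX + 2 * gX = 2 * gXX) (hgWX : gWX + gWX = 2 * gWX)
  (hgXX : gXX + gXX = 2 * gXX) (hgT₁ : gT₁ + gT₁ = nT₁) (hgT : gT + gT = 2 * gT)
  {a c₁ c l₀ l₃ : ℕ} (hac₁ : gW + a = c₁) (h0 : l₀ + 2 * c₁ = nT₁) (h0' : l₀ + 2 * a = 2 * gWX)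
  (hac : a + gX = c) (h3 : l₃ + 2 * c = 2 * gT) (h3' : l₃ + 2 * a = 2 * gWX)
  {p q₁ d l₁ : ℕ} (hq₁ : a + p = q₁) (h1 : l₁ + 2 * q₁ = 2 * gWX) (h1' : l₁ + 2 * d = 2 * gX)
  {q t₂ d' L₁ L₂ : ℕ} (ht₂ : a + q = t₂) (k1' : L₁ + 2 * q = 2 * gX) (k2 : L₂ + 2 * t₂ = 2 * gWX) (k2' : L₂ + 2 * d' = 2 * gW)

/-! ### §1 `(α ∘ π_{s,W})_* = δ_{s,2p} · α_*` on `Hdgᵖ(W, ℤ)` -/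

include hgg₁ hgg₂ hggT hX0 hcX eXX eT hgXX hgT hac h3 h3' in
/-- **`(α ∘ π_{s,W})_*(x) = δ_{s,2p} · α_*(x)`** for `α ∈ Hdgᵃ(W × X, ℤ)`, `x ∈ Hdgᵖ(W, ℤ)` (`α_*(x) = p_{X*}(α · p_W^*x) ∈ Hdgᵈ(X, ℤ)`, `d = a + p − dim W`): restricted to
the Künneth component `π_{s,W}` of its source, the correspondence acts on `Hdgᵖ(W, ℤ) ⊂ H^{2p}(W, ℤ)` as `α` if `s = 2p` and by zero otherwise (Prop. 16.1.2 (a)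
`(α ∘ π_s)_* = α_* ∘ (π_s)_*`, `(π_{s,W})_*` = the projector onto `Hˢ(W)`). Proof: `α ∘ π_{s,W} = π_{t,X} ∘ α` with `t + 2 dim W = 2a + s` (g31-#2) and g30-#11
(`t = 2d ⇔ s = 2p`); when `2a + s < 2 dim W` the composite vanishes (g29-#8) and `s = 2p` would force `d < 0`.
[cite: Fulton1998, §16.1 Def. 16.1.2, Prop. 16.1.2 (a) (p0295 L9–L22) and Example 16.1.15 (p0302 L27–L33)]
[cite: Lange2023AbelianVarietiesComplex, §6.3.4 Prop. 6.3.11 (p0319 L9–L21)] [cite: VoisinHodgeI2002, §11.3.3 Lemma 11.41 and p. 287] -/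
theorem integralHodgeClassesCorrComp_kunnethProjector_right_act (α : integralHodgeClasses (prodObj W X).toIsog.Φ a) (s : ℕ) (x : integralHodgeClasses W.toIsog.Φ p) :
    integralHodgeClassesPushforward q₁ d (sndHom W X) eWX eX h1 hgWX h1' hgX
      (integralHodgeClassesCup (prodObj W X).toIsog.Φ hq₁
        (integralHodgeClassesPushforward c₁ a (liftHom (fstHom W (prodObj W X)) (sndHom W (prodObj W X) ≫ sndHom W X)) eT₁ eWX h0 hgT₁ h0' hgWX
          (integralHodgeClassesCup (prodObj W (prodObj W X)).toIsog.Φ hac₁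
            (integralHodgeClassesPullbackHom (liftHom (fstHom W (prodObj W X)) (sndHom W (prodObj W X) ≫ fstHom W X)) gW (kunnethProjector W eW eWW hW0 hgW hcW hgWW s))
            (integralHodgeClassesPullbackHom (sndHom W (prodObj W X)) a α)))
        (integralHodgeClassesPullbackHom (fstHom W X) p x)) =
      if 2 * p = s then
        integralHodgeClassesPushforward q₁ d (sndHom W X) eWX eX h1 hgWX h1' hgX
          (integralHodgeClassesCup (prodObj W X).toIsog.Φ hq₁ α (integralHodgeClassesPullbackHom (fstHom W X) p x))
      else 0 := by
  by_cases hs : 2 * a + s < 2 * gW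
  · rw [integralHodgeClassesCorrComp_kunnethProjector_right_eq_zero eW eWW hW0 hgW hcW hgWW eT₁ eWX hac₁ h0 hgT₁ h0' hgWX α hs, map_zero,
      AddMonoidHom.zero_apply, map_zero, if_neg (by omega)]
  · obtain ⟨t, ht⟩ : ∃ t : ℕ, t + 2 * gW = 2 * a + s := ⟨2 * a + s - 2 * gW, by omega⟩
    rw [integralHodgeClassesCorrComp_kunnethProjector_comm eW eWW hW0 hgW hcW hgWW eX eXX hX0 hgX hcX hgXX eT₁ eT eWX hac₁ h0 hgT₁ h0' hgWX hac h3 hgT h3' α s t ht,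
      integralHodgeClassesCorrComp_kunnethProjector_act hgg₂ hggT eX eWX eXX eT hX0 hgX hcX hgWX hgXX hgT hac h3 h3' hq₁ h1 h1' α t x]
    by_cases h : 2 * p = s
    · rw [if_pos h, if_pos (by omega)]
    · rw [if_neg h, if_neg (by omega)]

include hgg₁ hgg₂ hggT hX0 hcX eXX eT hgXX hgT hac h3 h3' in
/-- **`α_*(x) = (α ∘ π_{2p,W})_*(x)`** for `α ∈ Hdgᵃ(W × X, ℤ)`, `x ∈ Hdgᵖ(W, ℤ)`: on `Hdgᵖ(W, ℤ)` the correspondence acts through its Künneth component of degree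
`2p` in the source variables alone. [cite: VoisinHodgeI2002, §11.3.3 Lemma 11.41 and (11.11) (p0236 L27–L40, p0237 L1–L3)] [cite: Fulton1998, §16.1 Example 16.1.15 (p0302 L27–L33)] -/
theorem integralHodgeClassesCorrComp_kunnethProjector_right_act_self (α : integralHodgeClasses (prodObj W X).toIsog.Φ a) (x : integralHodgeClasses W.toIsog.Φ p) :
    integralHodgeClassesPushforward q₁ d (sndHom W X) eWX eX h1 hgWX h1' hgX
        (integralHodgeClassesCup (prodObj W X).toIsog.Φ hq₁ α (integralHodgeClassesPullbackHom (fstHom W X) p x)) =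
      integralHodgeClassesPushforward q₁ d (sndHom W X) eWX eX h1 hgWX h1' hgX
        (integralHodgeClassesCup (prodObj W X).toIsog.Φ hq₁
          (integralHodgeClassesPushforward c₁ a (liftHom (fstHom W (prodObj W X)) (sndHom W (prodObj W X) ≫ sndHom W X)) eT₁ eWX h0 hgT₁ h0' hgWX
            (integralHodgeClassesCup (prodObj W (prodObj W X)).toIsog.Φ hac₁
              (integralHodgeClassesPullbackHom (liftHom (fstHom W (prodObj W X)) (sndHom W (prodObj W X) ≫ fstHom W X)) gW
                (kunnethProjector W eW eWW hW0 hgW hcW hgWW (2 * p)))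
              (integralHodgeClassesPullbackHom (sndHom W (prodObj W X)) a α)))
          (integralHodgeClassesPullbackHom (fstHom W X) p x)) := by
  rw [integralHodgeClassesCorrComp_kunnethProjector_right_act hgg₁ hgg₂ hggT eW eX eWW eWX eXX eT₁ eT hW0 hgW hcW hgWW hX0 hgX hcX hgWX hgXX hgT₁ hgT hac₁ h0 h0'
    hac h3 h3' hq₁ h1 h1' α (2 * p) x, if_pos rfl]

/-! ### §2 `(α ∘ π_{s,W})^* = δ_{s + 2d′, 2 dim W} · α^*` into `Hdg^{d′}(W, ℤ)` -/

include hgg₁ hgg₂ hggT eX hX0 hgX hcX eXX eT hgXX hgT hac h3 h3' k1' in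
/-- **`(α ∘ π_{s,W})^*(y) = δ_{s + 2d′, 2 dim W} · α^*(y)`** for `α ∈ Hdgᵃ(W × X, ℤ)`, `y ∈ Hdgᵠ(X, ℤ)`, `α^*(y) = p_{W*}(α · p_X^*y) ∈ Hdg^{d′}(W, ℤ)`: `(α ∘ π_s)^* =
(π_s)^* ∘ α^*` (Prop. 16.1.2 (a)) and `(π_{s,W})^* = (ᵗπ_{s,W})_* = (π_{2g−s,W})_*` (Prop. 6.3.10) keeps `H^{2g−s}(W)`, i.e. `H^{2d′}(W)` exactly when `s + 2d′ = 2
dim W`. Proof: g31-#2's commutation to `π_{t,X} ∘ α` and g30-#11's `…_coact` (`t + 2q = 2 dim X ⇔ s + 2d′ = 2 dim W`); the out-of-range case by g29-#8.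
[cite: Fulton1998, §16.1 Def. 16.1.2, Prop. 16.1.2 (a) (p0295 L9–L22) and Example 16.1.15 (p0302 L27–L33)]
[cite: Lange2023AbelianVarietiesComplex, §6.3.4 Prop. 6.3.10 (p0318 L47) and Prop. 6.3.11 (p0319 L9–L21)] [cite: VoisinHodgeI2002, §11.3.3 Lemma 11.41 (p0236 L27–L40)] -/
theorem integralHodgeClassesCorrComp_kunnethProjector_right_coact (α : integralHodgeClasses (prodObj W X).toIsog.Φ a) (s : ℕ) (y : integralHodgeClasses X.toIsog.Φ q) :
    integralHodgeClassesPushforward t₂ d' (fstHom W X) eWX eW k2 hgWX k2' hgW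
      (integralHodgeClassesCup (prodObj W X).toIsog.Φ ht₂
        (integralHodgeClassesPushforward c₁ a (liftHom (fstHom W (prodObj W X)) (sndHom W (prodObj W X) ≫ sndHom W X)) eT₁ eWX h0 hgT₁ h0' hgWX
          (integralHodgeClassesCup (prodObj W (prodObj W X)).toIsog.Φ hac₁
            (integralHodgeClassesPullbackHom (liftHom (fstHom W (prodObj W X)) (sndHom W (prodObj W X) ≫ fstHom W X)) gW (kunnethProjector W eW eWW hW0 hgW hcW hgWW s))
            (integralHodgeClassesPullbackHom (sndHom W (prodObj W X)) a α)))
        (integralHodgeClassesPullbackHom (sndHom W X) q y)) =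
      if s + 2 * d' = 2 * gW then
        integralHodgeClassesPushforward t₂ d' (fstHom W X) eWX eW k2 hgWX k2' hgW
          (integralHodgeClassesCup (prodObj W X).toIsog.Φ ht₂ α (integralHodgeClassesPullbackHom (sndHom W X) q y))
      else 0 := by
  by_cases hs : 2 * a + s < 2 * gW
  · rw [integralHodgeClassesCorrComp_kunnethProjector_right_eq_zero eW eWW hW0 hgW hcW hgWW eT₁ eWX hac₁ h0 hgT₁ h0' hgWX α hs, map_zero,
      AddMonoidHom.zero_apply, map_zero, if_neg (by omega)]
  · obtain ⟨t, ht⟩ : ∃ t : ℕ, t + 2 * gW = 2 * a + s := ⟨2 * a + s - 2 * gW, by omega⟩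
    rw [integralHodgeClassesCorrComp_kunnethProjector_comm eW eWW hW0 hgW hcW hgWW eX eXX hX0 hgX hcX hgXX eT₁ eT eWX hac₁ h0 hgT₁ h0' hgWX hac h3 hgT h3' α s t ht,
      integralHodgeClassesCorrComp_kunnethProjector_coact hgg₁ hgg₂ hggT eW eX eWX eXX eT hX0 hgW hgX hcX hgWX hgXX hgT hac h3 h3' ht₂ k1' k2 k2' α t y]
    by_cases h : s + 2 * d' = 2 * gW
    · rw [if_pos h, if_pos (by omega)]
    · rw [if_neg h, if_neg (by omega)]

include hgg₁ hgg₂ hggT eX hX0 hgX hcX eXX eT hgXX hgT hac h3 h3' k1' in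
/-- **`α^*(y) = (α ∘ π_{2 dim W − 2d′,W})^*(y)`** for `α ∈ Hdgᵃ(W × X, ℤ)`, `y ∈ Hdgᵠ(X, ℤ)`, `α^*(y) ∈ Hdg^{d′}(W, ℤ)`: the transpose action into `Hdg^{d′}(W, ℤ)` is that of
the Künneth component of `α` of `W`-degree `2d′` (`= 2 dim W − s` for `s = 2 dim W − 2d′`). [cite: VoisinHodgeI2002, §11.3.3 Lemma 11.41 and (11.11) (p0236 L27–L40, p0237 L1–L3)]
[cite: Lange2023AbelianVarietiesComplex, §6.3.4 Prop. 6.3.10 (p0318 L47)] [cite: Fulton1998, §16.1 Example 16.1.15 (p0302 L27–L33)] -/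
theorem integralHodgeClassesCorrComp_kunnethProjector_right_coact_self (α : integralHodgeClasses (prodObj W X).toIsog.Φ a) (y : integralHodgeClasses X.toIsog.Φ q) :
    integralHodgeClassesPushforward t₂ d' (fstHom W X) eWX eW k2 hgWX k2' hgW
        (integralHodgeClassesCup (prodObj W X).toIsog.Φ ht₂ α (integralHodgeClassesPullbackHom (sndHom W X) q y)) =
      integralHodgeClassesPushforward t₂ d' (fstHom W X) eWX eW k2 hgWX k2' hgW
        (integralHodgeClassesCup (prodObj W X).toIsog.Φ ht₂
          (integralHodgeClassesPushforward c₁ a (liftHom (fstHom W (prodObj W X)) (sndHom W (prodObj W X) ≫ sndHom W X)) eT₁ eWX h0 hgT₁ h0' hgWX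
            (integralHodgeClassesCup (prodObj W (prodObj W X)).toIsog.Φ hac₁
              (integralHodgeClassesPullbackHom (liftHom (fstHom W (prodObj W X)) (sndHom W (prodObj W X) ≫ fstHom W X)) gW
                (kunnethProjector W eW eWW hW0 hgW hcW hgWW (2 * gW - 2 * d')))
              (integralHodgeClassesPullbackHom (sndHom W (prodObj W X)) a α)))
          (integralHodgeClassesPullbackHom (sndHom W X) q y)) := by
  rw [integralHodgeClassesCorrComp_kunnethProjector_right_coact hgg₁ hgg₂ hggT eW eX eWW eWX eXX eT₁ eT hW0 hgW hcW hgWW hX0 hgX hcX hgWX hgXX hgT₁ hgT hac₁ h0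
    h0' hac h3 h3' ht₂ k1' k2 k2' α (2 * gW - 2 * d') y, if_pos (by omega)]

end SourceActions

end ComplexTorusCat

end Literature.AlgebraicGeometry.HodgeTheory
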